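import Literature.Computability.AlgebraicComplexity.GroupTheoreticMatMul
import Mathlib.Algebra.Group.Pointwise.Finset.Basic

/-!
# STPP families via difference sets: the criterion behind the mask engines, and the translation normal form

Cell `pub-omega`, STPP track (family b′), seat pub-omega-stpp-2 (gen 6). HONEST FRAMING: lottery ticket;
floor = certified bounds/negative ranges. This file proves NOTHING about `ω`; it puts into the kernel the
two elementary facts on which the seat's exhaustive STPP engines (`s222.c` / `sgen.c`, "difference-set
masks", `HOME/pub-omega-stpp-2-g5/ENGINE-g5.md` §A.1 Lemma 1–2 and §E; and the per-triple translation
normal form shared by every census engine) rest: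

* (T) **translation normal form** — translating each triple `(Aᵢ, Bᵢ, Cᵢ)` by its own element `gᵢ` and
  all `Bᵢ` (resp. all `Cᵢ`) by one common element leaves CKSU Def. 5.1 invariant
  (`isSTPP_translate`): the defining word `(s' − s) + (t' − t) + (u' − u)` does not change.
* (D) **difference-set criterion** — with `Lᵢ = Aᵢ − Bᵢ`, `Mᵢ = Bᵢ − Cᵢ`, `Nᵢ = Aᵢ − Cᵢ`, a family is
  STPP iff every triple has the TPP and `N_k ∩ (L_i + M_j) = ∅` for every index triple `(i, j, k)` that
  is not constant (`isSTPP_iff_tpp_and_disjoint`); and the three re-groupings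
  `Nᵢ − Lᵢ = Mᵢ + (Aᵢ − Aᵢ)`, `Nᵢ − Mᵢ = Lᵢ + (Cᵢ − Cᵢ)`, `Lᵢ + Mᵢ = Nᵢ + (Bᵢ − Bᵢ)`
  (`diffAC_sub_diffAB`, `diffAC_sub_diffBC`, `diffAB_add_diffBC`) that turn the two-index conditions into
  single-set membership tests.

All statements are for the tree's additive `IsSTPP` (CKSU 2005 Def. 5.1) in an arbitrary abelian group.
References: H. Cohn, R. Kleinberg, B. Szegedy, C. Umans, *Group-theoretic algorithms for matrix
multiplication*, FOCS 2005, arXiv:math/0511460, Def. 5.1; J. Blasiak et al., *On cap sets and the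
group-theoretic approach to matrix multiplication*, Discrete Analysis 2017:3, §3.1 (the sets
`S_i = A_i − B_i`, `T_i = B_i − C_i`, `U_i = C_i − A_i`).
-/

namespace Summit.MatrixMultiplication.OmegaCensus

open Finset Pointwise Literature.Computability.AlgebraicComplexity

variable {H : Type*} [AddCommGroup H] {N : ℕ} {A B C : Fin N → Finset H}

section Translation

variable [DecidableEq H]

/-- **Translation invariance of the STPP** (the normal form used by every census engine): translating the
`i`-th triple by `g i` (all three sets) and, on top, every `Bᵢ` by a common `b` and every `Cᵢ` by a
common `c` preserves CKSU Def. 5.1 — in the defining word `(s' − s) + (t' − t) + (u' − u)` with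
`s' ∈ A i, t ∈ B i`, `t' ∈ B j, u ∈ C j`, `u' ∈ C k, s ∈ A k` the shifts cancel:
`(gᵢ − g_k) + (g_j + b − gᵢ − b) + (g_k + c − g_j − c) = 0`. [folklore; CKSU 2005 after Def. 5.1] -/
theorem isSTPP_translate (hS : IsSTPP A B C) (g : Fin N → H) (b c : H) :
    IsSTPP (fun i => A i + {g i}) (fun i => B i + {g i + b}) (fun i => C i + {g i + c}) := by
  intro i j k s hs s' hs' t ht t' ht' u hu u' hu' h0
  obtain ⟨s₀, hs₀, z₁, hz₁, rfl⟩ := mem_add.1 hs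
  obtain ⟨s₀', hs₀', z₂, hz₂, rfl⟩ := mem_add.1 hs'
  obtain ⟨t₀, ht₀, z₃, hz₃, rfl⟩ := mem_add.1 ht
  obtain ⟨t₀', ht₀', z₄, hz₄, rfl⟩ := mem_add.1 ht'
  obtain ⟨u₀, hu₀, z₅, hz₅, rfl⟩ := mem_add.1 hu
  obtain ⟨u₀', hu₀', z₆, hz₆, rfl⟩ := mem_add.1 hu'
  rw [mem_singleton] at hz₁ hz₂ hz₃ hz₄ hz₅ hz₆
  subst hz₁ hz₂ hz₃ hz₄ hz₅ hz₆
  have e : (s₀' - s₀) + (t₀' - t₀) + (u₀' - u₀) = 0 := by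
    rw [← h0]; abel
  obtain ⟨hij, hjk, h1, h2, h3⟩ := hS i j k s₀ hs₀ s₀' hs₀' t₀ ht₀ t₀' ht₀' u₀ hu₀ u₀' hu₀' e
  subst hij; subst hjk; subst h1; subst h2; subst h3
  exact ⟨rfl, rfl, rfl, rfl, rfl⟩

/-- **Normal form**: an STPP family with non-empty sets can be translated, triple by triple, so that
`0 ∈ Aᵢ` for every `i` and, for one chosen index `i₀`, also `0 ∈ B_{i₀}` and `0 ∈ C_{i₀}`; the
cardinalities `|Aᵢ|, |Bᵢ|, |Cᵢ|` are unchanged. This is the "WLOG" at the root of every search tree of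
the census (`s222` (S1), `sgen`, `stppsearch`). [folklore] -/
theorem exists_isSTPP_normalised (hS : IsSTPP A B C) (hA : ∀ i, (A i).Nonempty) (i₀ : Fin N)
    (hB : (B i₀).Nonempty) (hC : (C i₀).Nonempty) :
    ∃ A' B' C' : Fin N → Finset H, IsSTPP A' B' C' ∧ (∀ i, (A' i).card = (A i).card) ∧
      (∀ i, (B' i).card = (B i).card) ∧ (∀ i, (C' i).card = (C i).card) ∧
      (∀ i, (0 : H) ∈ A' i) ∧ (0 : H) ∈ B' i₀ ∧ (0 : H) ∈ C' i₀ := by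
  choose a ha using hA
  obtain ⟨b₀, hb₀⟩ := hB
  obtain ⟨c₀, hc₀⟩ := hC
  refine ⟨fun i => A i + {-a i}, fun i => B i + {-a i + (a i₀ - b₀)}, fun i => C i + {-a i + (a i₀ - c₀)},
    isSTPP_translate hS (fun i => -a i) (a i₀ - b₀) (a i₀ - c₀), ?_, ?_, ?_, ?_, ?_, ?_⟩
  · intro i; exact card_add_singleton _ _
  · intro i; exact card_add_singleton _ _
  · intro i; exact card_add_singleton _ _
  · intro i; exact mem_add.2 ⟨a i, ha i, -a i, mem_singleton_self _, by abel⟩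
  · exact mem_add.2 ⟨b₀, hb₀, -a i₀ + (a i₀ - b₀), mem_singleton_self _, by abel⟩
  · exact mem_add.2 ⟨c₀, hc₀, -a i₀ + (a i₀ - c₀), mem_singleton_self _, by abel⟩

end Translation

section DifferenceSets

variable [DecidableEq H]

/-- **The difference-set criterion** (ENGINE-g5 §A.1 Lemma 1, general sets): a family `(Aᵢ, Bᵢ, Cᵢ)` is an
STPP family iff (i) every triple has the triple product property and (ii) for every index triple
`(i, j, k)` that is not constant, `A_k − C_k` is disjoint from `(A_i − B_i) + (B_j − C_j)`.
Proof: the defining word is `(s' − t) + (t' − u) − (s − u')` with `s' − t ∈ Aᵢ − Bᵢ`, `t' − u ∈ Bⱼ − Cⱼ`,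
`s − u' ∈ A_k − C_k`. [cite: CohnKleinbergSzegedyUmans2005, Def. 5.1] -/
theorem isSTPP_iff_tpp_and_disjoint :
    IsSTPP A B C ↔
      (∀ i : Fin N, ∀ s ∈ A i, ∀ s' ∈ A i, ∀ t ∈ B i, ∀ t' ∈ B i, ∀ u ∈ C i, ∀ u' ∈ C i,
          (s' - s) + (t' - t) + (u' - u) = 0 → s = s' ∧ t = t' ∧ u = u') ∧
      (∀ i j k : Fin N, ¬ (i = j ∧ j = k) →
          Disjoint (A k - C k) ((A i - B i) + (B j - C j))) := by
  constructor
  · intro hS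
    refine ⟨fun i s hs s' hs' t ht t' ht' u hu u' hu' h0 => ?_, fun i j k hne => ?_⟩
    · obtain ⟨-, -, h⟩ := hS i i i s hs s' hs' t ht t' ht' u hu u' hu' h0
      exact h
    · rw [Finset.disjoint_left]
      intro x hx hx'
      obtain ⟨s, hs, u', hu', rfl⟩ := mem_sub.1 hx
      obtain ⟨y, hy, z, hz, hyz⟩ := mem_add.1 hx'
      obtain ⟨s', hs', t, ht, rfl⟩ := mem_sub.1 hy
      obtain ⟨t', ht', u, hu, rfl⟩ := mem_sub.1 hz
      have h0 : (s' - s) + (t' - t) + (u' - u) = 0 := by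
        have : (s' - s) + (t' - t) + (u' - u) = (s' - t + (t' - u)) - (s - u') := by abel
        rw [this, hyz, sub_self]
      obtain ⟨hij, hjk, -⟩ := hS i j k s hs s' hs' t ht t' ht' u hu u' hu' h0
      exact hne ⟨hij, hjk⟩
  · rintro ⟨hT, hX⟩ i j k s hs s' hs' t ht t' ht' u hu u' hu' h0
    by_cases hc : i = j ∧ j = k
    · obtain ⟨rfl, rfl⟩ := hc
      exact ⟨rfl, rfl, hT i s hs s' hs' t ht t' ht' u hu u' hu' h0⟩
    · exfalso
      have hx : s - u' ∈ A k - C k := sub_mem_sub hs hu'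
      have hx' : s - u' ∈ (A i - B i) + (B j - C j) := by
        refine mem_add.2 ⟨s' - t, sub_mem_sub hs' ht, t' - u, sub_mem_sub ht' hu, ?_⟩
        have : (s' - t) + (t' - u) = (s - u') + ((s' - s) + (t' - t) + (u' - u)) := by abel
        rw [this, h0, add_zero]
      exact Finset.disjoint_left.1 (hX i j k hc) hx hx'

/-- Re-grouping identity `N − L = M + (A − A)` for `L = A − B`, `M = B − C`, `N = A − C`
(ENGINE-g5 §A.1 Lemma 2, first identity): `(a − c) − (a' − b) = (b − c) + (a − a')`. [folklore] -/
theorem diffAC_sub_diffAB (A B C : Finset H) : (A - C) - (A - B) = (B - C) + (A - A) := by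
  ext x
  simp only [mem_sub, mem_add]
  constructor
  · rintro ⟨n, ⟨a, ha, c, hc, rfl⟩, l, ⟨a', ha', b, hb, rfl⟩, rfl⟩
    exact ⟨b - c, ⟨b, hb, c, hc, rfl⟩, a - a', ⟨a, ha, a', ha', rfl⟩, by abel⟩
  · rintro ⟨m, ⟨b, hb, c, hc, rfl⟩, d, ⟨a, ha, a', ha', rfl⟩, rfl⟩
    exact ⟨a - c, ⟨a, ha, c, hc, rfl⟩, a' - b, ⟨a', ha', b, hb, rfl⟩, by abel⟩

/-- Re-grouping identity `N − M = L + (C − C)` for `L = A − B`, `M = B − C`, `N = A − C`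
(ENGINE-g5 §A.1 Lemma 2, second identity): `(a − c) − (b − c') = (a − b) + (c' − c)`. [folklore] -/
theorem diffAC_sub_diffBC (A B C : Finset H) : (A - C) - (B - C) = (A - B) + (C - C) := by
  ext x
  simp only [mem_sub, mem_add]
  constructor
  · rintro ⟨n, ⟨a, ha, c, hc, rfl⟩, m, ⟨b, hb, c', hc', rfl⟩, rfl⟩
    exact ⟨a - b, ⟨a, ha, b, hb, rfl⟩, c' - c, ⟨c', hc', c, hc, rfl⟩, by abel⟩
  · rintro ⟨l, ⟨a, ha, b, hb, rfl⟩, d, ⟨c', hc', c, hc, rfl⟩, rfl⟩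
    exact ⟨a - c, ⟨a, ha, c, hc, rfl⟩, b - c', ⟨b, hb, c', hc', rfl⟩, by abel⟩

/-- Re-grouping identity `L + M = N + (B − B)` for `L = A − B`, `M = B − C`, `N = A − C`
(ENGINE-g5 §A.1 Lemma 2, third identity): `(a − b) + (b' − c) = (a − c) + (b' − b)`. [folklore] -/
theorem diffAB_add_diffBC (A B C : Finset H) : (A - B) + (B - C) = (A - C) + (B - B) := by
  ext x
  simp only [mem_sub, mem_add]
  constructor
  · rintro ⟨l, ⟨a, ha, b, hb, rfl⟩, m, ⟨b', hb', c, hc, rfl⟩, rfl⟩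
    exact ⟨a - c, ⟨a, ha, c, hc, rfl⟩, b' - b, ⟨b', hb', b, hb, rfl⟩, by abel⟩
  · rintro ⟨n, ⟨a, ha, c, hc, rfl⟩, d, ⟨b', hb', b, hb, rfl⟩, rfl⟩
    exact ⟨a - b, ⟨a, ha, b, hb, rfl⟩, b' - c, ⟨b', hb', c, hc, rfl⟩, by abel⟩

/-- **The two-index conditions as single-set tests** (ENGINE-g5 §A.1 "Consequence", the form the mask
engines evaluate): for `s ≠ t` the criterion's conditions with index triples `(t,t,s)` and `(s,t,t)`, i.e.
`Disjoint (A_s − C_s) ((A_t − B_t) + (B_t − C_t))` and `Disjoint (A_t − C_t) ((A_s − B_s) + (B_t − C_t))`,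
read `Disjoint N_s (N_t + (B_t − B_t))` resp. — by the third identity applied to the mixed pair —
membership tests against translates of single difference sets. Recorded here for the first one.
[folklore] -/
theorem disjoint_diffAC_mixed_iff (As Cs At Bt Ct : Finset H) :
    Disjoint (As - Cs) ((At - Bt) + (Bt - Ct)) ↔ Disjoint (As - Cs) ((At - Ct) + (Bt - Bt)) := by
  rw [diffAB_add_diffBC]

end DifferenceSets

section TPPTest

variable [DecidableEq H]

/-- **The TPP of one triple via difference sets** (the test evaluated by `sgen.c`, ENGINE-g5 §E:
`TPP ⇔ (D(A)∖0) ∩ D(B) = ∅ ∧ (D(C)∖0) ∩ (D(A)+D(B)) = ∅` with `D(S) = S − S`): for `C` non-empty, a triple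
`(A, B, C)` of finite subsets of an abelian group has the triple product property (the `i = j = k`
clause of CKSU Def. 5.1) iff `(A − A) ∩ (B − B) ⊆ {0}` and `(C − C) ∩ ((A − A) + (B − B)) ⊆ {0}`.
(With `C = ∅` the TPP clause is vacuous while the first condition need not hold, whence the hypothesis.)
[cite: CohnKleinbergSzegedyUmans2005, Def. 5.1] -/
theorem tpp_iff_diff_inter (A B C : Finset H) (hC : C.Nonempty) :
    (∀ s ∈ A, ∀ s' ∈ A, ∀ t ∈ B, ∀ t' ∈ B, ∀ u ∈ C, ∀ u' ∈ C,
        (s' - s) + (t' - t) + (u' - u) = 0 → s = s' ∧ t = t' ∧ u = u') ↔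
      ((A - A) ∩ (B - B) ⊆ {0} ∧ (C - C) ∩ ((A - A) + (B - B)) ⊆ {0}) := by
  constructor
  · intro hT
    refine ⟨fun x hx => ?_, fun x hx => ?_⟩
    · rw [mem_inter] at hx
      rw [mem_singleton]
      obtain ⟨a, ha, a', ha', rfl⟩ := mem_sub.1 hx.1
      obtain ⟨b, hb, b', hb', hbb⟩ := mem_sub.1 hx.2
      obtain ⟨c, hc⟩ := hC
      have h0 : (a - a') + (b' - b) + (c - c) = 0 := by
        have : (a - a') + (b' - b) + (c - c) = (a - a') - (b - b') := by abel
        rw [this, hbb, sub_self]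
      obtain ⟨h1, -, -⟩ := hT a' ha' a ha b hb b' hb' c hc c hc h0
      rw [h1, sub_self]
    · rw [mem_inter] at hx
      rw [mem_singleton]
      obtain ⟨c, hc, c', hc', rfl⟩ := mem_sub.1 hx.1
      obtain ⟨y, hy, z, hz, hyz⟩ := mem_add.1 hx.2
      obtain ⟨a, ha, a', ha', rfl⟩ := mem_sub.1 hy
      obtain ⟨b, hb, b', hb', rfl⟩ := mem_sub.1 hz
      have h0 : (a' - a) + (b' - b) + (c - c') = 0 := by
        have : (a' - a) + (b' - b) + (c - c') = (c - c') - ((a - a') + (b - b')) := by abel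
        rw [this, hyz, sub_self]
      obtain ⟨-, -, h3⟩ := hT a ha a' ha' b hb b' hb' c' hc' c hc h0
      rw [h3, sub_self]
  · rintro ⟨h1, h2⟩ s hs s' hs' t ht t' ht' u hu u' hu' h0
    have hu0 : u - u' = 0 := by
      refine mem_singleton.1 (h2 (mem_inter.2 ⟨sub_mem_sub hu hu', ?_⟩))
      refine mem_add.2 ⟨s' - s, sub_mem_sub hs' hs, t' - t, sub_mem_sub ht' ht, ?_⟩
      have : (s' - s) + (t' - t) = (u - u') + ((s' - s) + (t' - t) + (u' - u)) := by abel
      rw [this, h0, add_zero]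
    have huu : u = u' := sub_eq_zero.1 hu0
    have hs0 : s' - s = 0 := by
      refine mem_singleton.1 (h1 (mem_inter.2 ⟨sub_mem_sub hs' hs, ?_⟩))
      refine mem_sub.2 ⟨t, ht, t', ht', ?_⟩
      have : t - t' = (s' - s) - ((s' - s) + (t' - t) + (u' - u)) + (u' - u) := by abel
      rw [this, h0, huu, sub_self, sub_zero, add_zero]
    have hss : s = s' := (sub_eq_zero.1 hs0).symm
    refine ⟨hss, ?_, huu⟩
    have : t' - t = 0 := by
      have e : t' - t = ((s' - s) + (t' - t) + (u' - u)) - (s' - s) - (u' - u) := by abel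
      rw [e, h0, hs0, huu, sub_self, sub_self, zero_sub, neg_zero]
    exact ((sub_eq_zero.1 this).symm ▸ rfl : t = t')

end TPPTest

end Summit.MatrixMultiplication.OmegaCensus
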